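import Literature.AlgebraicGeometry.AbelianVarieties.PhiLOntoOfInjective
import Literature.AlgebraicGeometry.AbelianSchemes.PhiLInjectiveCharZero
import HarnessLib

/-!
# A Čech `2`-cocycle which is a sum of cup products of `1`-cocycles is `θ ⌣ dlog g` up to a coboundary,
# for a tangent-valued `1`-cocycle `θ` — abelian varieties in characteristic `0`

Topic `AlgebraicGeometry/AbelianSchemes`.  THEOREMS ONLY (no `def`, no instance, no notation, no `sorry`).
Cell hodgecm-mathlib, F-11 road A, grandchild line `F11LiftWithLineBundle`, stub G2 `stub_lineBundleLiftOfSomeLift`,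
step (iii-c) «coherent input»: the (I1) socket of the MONO-G2 assembly MODULO the cup-product decomposition J3.

Setting ([MumfordAV1970] §13, proof of the Theorem, pp. 125–130; [Oort1971] §2.3 Lemma 2.3.3; [MumfordFogartyKirwan1994]
App. 7A p. 235 «the obstruction to lifting the polarization can be killed by changing the lifting»): `A` an abelian scheme
over `Spec k`, `k` a field of characteristic `0`; `L` of rank one on `A`, rigidified along the unit section (`hε`) and
geometrically of the class of an ample divisor (`hΘ`); `U` a finite affine open cover of `A`; `F : IFrames L U` rank-one
frames with transition units `g_{jl} = F.tf j l` and inverses `g_{lm}⁻¹ = F.tfOn m l _`.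

* **`AbelianSchemeOver.exists_tangentCocycle_of_sum_cup`** — if a Čech `2`-cochain `s` of `𝒪_A` on `U` is a finite sum of
  cup products of Čech `1`-cocycles plus a coboundary,
  `s_{jlm} = ∑ᵢ aᵢ_{jl}| · cᵢ_{lm}| + (h′_{jm}| − h′_{jl}| − h′_{lm}|)`,
  then there are local vector fields `θ_{jl} : Ω¹_{A/k}|_{U_j ∩ U_l} → 𝒪_A|_{U_j ∩ U_l}` forming a Čech `1`-cocycle and a
  `1`-cochain `h` with `s_{jlm} = g_{lm}⁻¹| · θ_{jl}|(d g_{lm}|) + (h_{jm}| − h_{jl}| − h_{lm}|)` — the letters `θ`,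
  `hθcoc`, `h`, `hsh` consumed by ★ `Deformation.exact_correctedUnits_of_move` (with `g := F.tf`, `gi l m := F.tfOn m l _`).

Proof: by ★ `AbelianVariety.exists_vectorField_of_cechOneCocycle_of_injective` ((I2-C), `φ_L` injective ⇒ onto, the
dimension count `dim Lie A = g = dim Ȟ¹(𝔘, 𝒪_A)`) fed with ★ `AbelianSchemeOver.vectorField_eq_zero_of_contracted_dlog_coboundary`
((I2-a)/(δ), `φ_L` injective for `L` rigidified of ample class), every `1`-cocycle `cᵢ` reads
`cᵢ_{lm} = g_{lm}⁻¹ · Dᵢ(dg_{lm}) + (hᵢ_m| − hᵢ_l|)` for a GLOBAL vector field `Dᵢ`; put `θ_{jl} := ∑ᵢ aᵢ_{jl} • Dᵢ|` (a cocycle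
because the `aᵢ` are) and `h_{jl} := h′_{jl} + ∑ᵢ aᵢ_{jl} · hᵢ_l|` (the Leibniz bookkeeping `a ⌣ δhᵢ = −δ(a ⌣₀ hᵢ)` for a
cocycle `a`).  Together with J3 «`Ȟ¹(𝒪_A) ⊗ Ȟ¹(𝒪_A) ↠ Ȟ²(𝒪_A)` on `U`» this is [MumfordAV1970] §13's «every class of
`H²(𝒪)` is killed by moving the lift», in the chart dialect of `Deformation/PairLiftObstructionMove`.

HC_CM is proved only modulo the 7 printed citations until rung 0 closes; this file is generic abelian-scheme geometry and
asserts nothing about HC.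

## References
* [MumfordAV1970] D. Mumford, *Abelian Varieties* (1970), §13, proof of the Theorem (pp. 125–130).
* [Oort1971] F. Oort, *Finite group schemes, local moduli for abelian varieties, and lifting problems* (1971), §2.3 Lemma 2.3.3.
* [MumfordFogartyKirwan1994] D. Mumford, J. Fogarty, F. Kirwan, *Geometric Invariant Theory*, 3rd ed. (1994), App. 7A (p. 235).
-/

noncomputable section

open CategoryTheory CategoryTheory.Limits AlgebraicGeometry Opposite TopologicalSpace

namespace Literature.AlgebraicGeometry.AbelianSchemes

open Literature.AlgebraicGeometry.Motives Literature.AlgebraicGeometry.Modules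
  Literature.AlgebraicGeometry.Morphisms Literature.AlgebraicGeometry.HodgeTheory
  Literature.AlgebraicGeometry.AbelianVarieties

/-- Composite restrictions of sections of the structure sheaf (plumbing). [folklore] -/
private theorem presheaf_map_map {Y : Scheme} {U₁ U₂ U₃ : Y.Opens} (h₁ : U₂ ≤ U₁) (h₂ : U₃ ≤ U₂)
    (h₃ : U₃ ≤ U₁) (x : Γ(Y, U₁)) :
    Y.presheaf.map (homOfLE h₂).op (Y.presheaf.map (homOfLE h₁).op x) = Y.presheaf.map (homOfLE h₃).op x := by
  rw [← CommRingCat.comp_apply, ← Functor.map_comp]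
  rfl

/-- Restriction of a finite sum of local homomorphisms (plumbing). [folklore] -/
private theorem restrictHom_sum {Y : Scheme} {E M : Y.Modules} {W W' : Y.Opens} (i : W' ⟶ W) {κ : Type*}
    (t : Finset κ) (φ : κ → (E.over W ⟶ M.over W)) :
    restrictHom i (∑ n ∈ t, φ n) = ∑ n ∈ t, restrictHom i (φ n) :=
  map_sum (AddMonoidHom.mk' (restrictHom i) (restrictHom_add i)) φ t

/-- Restricting a global homomorphism twice is restricting it once (plumbing). [folklore] -/
private theorem restrictHom_restrictHom_top {Y : Scheme} {E M : Y.Modules} {V W : Y.Opens} (i : W ⟶ V)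
    (φ : E.over ⊤ ⟶ M.over ⊤) :
    restrictHom i (restrictHom (homOfLE (le_top : V ≤ ⊤)) φ) = restrictHom (homOfLE (le_top : W ≤ ⊤)) φ := by
  rw [← restrictHom_comp', Subsingleton.elim (i ≫ homOfLE (le_top : V ≤ ⊤)) (homOfLE (le_top : W ≤ ⊤))]

/-- The commutative-algebra bookkeeping of the proof: with `α^{jl}_i + α^{lm}_i = α^{jm}_i`,
`∑ᵢ α^{jl}_i (g δᵢ + (ε^m_i − ε^l_i)) + (H_{jm} − H_{jl} − H_{lm})
 = g ∑ᵢ α^{jl}_i δᵢ + ((H_{jm} + ∑ᵢ α^{jm}_i ε^m_i) − (H_{jl} + ∑ᵢ α^{jl}_i ε^l_i) − (H_{lm} + ∑ᵢ α^{lm}_i ε^m_i))`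
(the Leibniz rule `a ⌣ δe = −δ(a ⌣₀ e)` for a `1`-cocycle `a`). [folklore] -/
private theorem sum_bookkeeping {R : Type*} [CommRing R] {σ : Type*} [Fintype σ]
    (αjl αlm αjm δ εl εm : σ → R) (g Hjm Hjl Hlm : R) (hα : ∀ i, αjl i + αlm i = αjm i) :
    ∑ i, αjl i * (g * δ i + (εm i - εl i)) + (Hjm - Hjl - Hlm) =
      g * ∑ i, αjl i * δ i +
        ((Hjm + ∑ i, αjm i * εm i) - (Hjl + ∑ i, αjl i * εl i) - (Hlm + ∑ i, αlm i * εm i)) := by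
  have hi : ∀ i, αjl i * (g * δ i + (εm i - εl i)) =
      g * (αjl i * δ i) + (αjm i * εm i - αjl i * εl i - αlm i * εm i) := fun i => by
    linear_combination (εm i) * hα i
  rw [Finset.sum_congr rfl fun i _ => hi i, Finset.sum_add_distrib, Finset.sum_sub_distrib,
    Finset.sum_sub_distrib, ← Finset.mul_sum]
  ring

/-- **A sum of cup products of Čech `1`-cocycles of `𝒪_A` is `g⁻¹ · θ(dg)` up to a coboundary, for a tangent-valued Čech
`1`-cocycle `θ`** (abelian scheme `A` over a field of characteristic `0`; `L` of rank one, rigidified (`hε`), geometrically of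
an ample class (`hΘ`), framed by `F` on the finite affine open cover `U`, `g_{jl} = F.tf j l`).  If
`s_{jlm} = ∑ᵢ aᵢ_{jl}| · cᵢ_{lm}| + (h′_{jm}| − h′_{jl}| − h′_{lm}|)` with all `aᵢ`, `cᵢ` Čech `1`-cocycles, then
`s_{jlm} = g_{lm}⁻¹| · θ_{jl}|(d g_{lm}|) + (h_{jm}| − h_{jl}| − h_{lm}|)` for local vector fields `θ_{jl}` on `U_j ∩ U_l`
satisfying the cocycle identity and a `1`-cochain `h` (the letters of ★ `Deformation.exact_correctedUnits_of_move`).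
Each `cᵢ` is `g⁻¹ · Dᵢ(dg) + δhᵢ` for a global vector field `Dᵢ` (★ `φ_L` injective ⇒ onto); `θ_{jl} := ∑ᵢ aᵢ_{jl} • Dᵢ|`,
`h := h′ + ∑ᵢ aᵢ ⌣₀ hᵢ`.
[cite: MumfordAV1970, §13, proof of the Theorem (pp. 125–130)] [cite: Oort1971, §2.3 Lemma 2.3.3]
[cite: MumfordFogartyKirwan1994, App. 7A (p. 235)] -/
theorem AbelianSchemeOver.exists_tangentCocycle_of_sum_cup {k : Type} [Field k] [CharZero k]
    (A : AbelianSchemeOver (Spec (.of k))) {L : A.left.Modules} (hL : HasRank L 1)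
    (hε : CechPic.pullback A.unitSection (detClass (HasRank.isFiniteLocallyFree' hL)) = 1)
    (hΘ : ∀ ⦃Ω : Type⦄ [Field Ω] [IsAlgClosed Ω] (s : Spec (.of Ω) ⟶ Spec (.of k)),
      ∃ Θ : CartierDivisor (A.fibre s).toAbelianVariety.X.left, Θ.IsAmple ∧
        CechPic.pullback (X := (A.fibre s).toAbelianVariety.X.left) (pullback.fst A.X.hom s)
          (detClass (HasRank.isFiniteLocallyFree' hL)) = Θ.cechClass)
    {ι : Type} [Finite ι] (U : ι → A.X.left.affineOpens) (hcov : ⨆ j, (U j).1 = ⊤)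
    (F : IFrames L (fun j => (U j).1))
    (s : (j l m : ι) → Γ(A.X.left, (U j).1 ⊓ (U l).1 ⊓ (U m).1))
    {σ : Type} [Fintype σ] (a c : σ → (j l : ι) → Γ(A.X.left, (U j).1 ⊓ (U l).1))
    (ha : ∀ (i : σ) (j l m : ι),
      A.X.left.presheaf.map (homOfLE (inf_le_left : (U j).1 ⊓ (U l).1 ⊓ (U m).1 ≤ (U j).1 ⊓ (U l).1)).op (a i j l) +
          A.X.left.presheaf.map (homOfLE (le_inf (inf_le_left.trans inf_le_right) inf_le_right :
            (U j).1 ⊓ (U l).1 ⊓ (U m).1 ≤ (U l).1 ⊓ (U m).1)).op (a i l m) =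
        A.X.left.presheaf.map (homOfLE (le_inf (inf_le_left.trans inf_le_left) inf_le_right :
          (U j).1 ⊓ (U l).1 ⊓ (U m).1 ≤ (U j).1 ⊓ (U m).1)).op (a i j m))
    (hc : ∀ (i : σ) (j l m : ι),
      A.X.left.presheaf.map (homOfLE (inf_le_left : (U j).1 ⊓ (U l).1 ⊓ (U m).1 ≤ (U j).1 ⊓ (U l).1)).op (c i j l) +
          A.X.left.presheaf.map (homOfLE (le_inf (inf_le_left.trans inf_le_right) inf_le_right :
            (U j).1 ⊓ (U l).1 ⊓ (U m).1 ≤ (U l).1 ⊓ (U m).1)).op (c i l m) =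
        A.X.left.presheaf.map (homOfLE (le_inf (inf_le_left.trans inf_le_left) inf_le_right :
          (U j).1 ⊓ (U l).1 ⊓ (U m).1 ≤ (U j).1 ⊓ (U m).1)).op (c i j m))
    (h' : (j l : ι) → Γ(A.X.left, (U j).1 ⊓ (U l).1))
    (hJ3 : ∀ j l m : ι, s j l m =
      ∑ i, A.X.left.presheaf.map (homOfLE (inf_le_left : (U j).1 ⊓ (U l).1 ⊓ (U m).1 ≤ (U j).1 ⊓ (U l).1)).op (a i j l) *
          A.X.left.presheaf.map (homOfLE (le_inf (inf_le_left.trans inf_le_right) inf_le_right :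
            (U j).1 ⊓ (U l).1 ⊓ (U m).1 ≤ (U l).1 ⊓ (U m).1)).op (c i l m) +
      (A.X.left.presheaf.map (homOfLE (le_inf (inf_le_left.trans inf_le_left) inf_le_right :
            (U j).1 ⊓ (U l).1 ⊓ (U m).1 ≤ (U j).1 ⊓ (U m).1)).op (h' j m) -
          A.X.left.presheaf.map (homOfLE (inf_le_left : (U j).1 ⊓ (U l).1 ⊓ (U m).1 ≤ (U j).1 ⊓ (U l).1)).op (h' j l) -
          A.X.left.presheaf.map (homOfLE (le_inf (inf_le_left.trans inf_le_right) inf_le_right :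
            (U j).1 ⊓ (U l).1 ⊓ (U m).1 ≤ (U l).1 ⊓ (U m).1)).op (h' l m))) :
    ∃ (θ : (j l : ι) → ((cotangentSheaf A.X).over ((U j).1 ⊓ (U l).1) ⟶ (unitModule A.X.left).over ((U j).1 ⊓ (U l).1)))
      (_ : ∀ j l m : ι,
        restrictHom (homOfLE (inf_le_left : (U j).1 ⊓ (U l).1 ⊓ (U m).1 ≤ (U j).1 ⊓ (U l).1)) (θ j l) +
          restrictHom (homOfLE (le_inf (inf_le_left.trans inf_le_right) inf_le_right :
            (U j).1 ⊓ (U l).1 ⊓ (U m).1 ≤ (U l).1 ⊓ (U m).1)) (θ l m) =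
          restrictHom (homOfLE (le_inf (inf_le_left.trans inf_le_left) inf_le_right :
            (U j).1 ⊓ (U l).1 ⊓ (U m).1 ≤ (U j).1 ⊓ (U m).1)) (θ j m))
      (h : (j l : ι) → Γ(A.X.left, (U j).1 ⊓ (U l).1)),
      ∀ j l m : ι, s j l m =
        A.X.left.presheaf.map (homOfLE (le_inf (inf_le_left.trans inf_le_right) inf_le_right :
            (U j).1 ⊓ (U l).1 ⊓ (U m).1 ≤ (U l).1 ⊓ (U m).1)).op
            (F.tfOn m l ((U l).1 ⊓ (U m).1) inf_le_right inf_le_left) *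
          (show Γ(A.X.left, (U j).1 ⊓ (U l).1 ⊓ (U m).1) from
            appLE (restrictHom (homOfLE (inf_le_left : (U j).1 ⊓ (U l).1 ⊓ (U m).1 ≤ (U j).1 ⊓ (U l).1)) (θ j l))
              (𝟙 _) (dSection A.X _ (A.X.left.presheaf.map (homOfLE (le_inf (inf_le_left.trans inf_le_right)
                inf_le_right : (U j).1 ⊓ (U l).1 ⊓ (U m).1 ≤ (U l).1 ⊓ (U m).1)).op (F.tf l m)))) +
        (A.X.left.presheaf.map (homOfLE (le_inf (inf_le_left.trans inf_le_left) inf_le_right :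
            (U j).1 ⊓ (U l).1 ⊓ (U m).1 ≤ (U j).1 ⊓ (U m).1)).op (h j m) -
          A.X.left.presheaf.map (homOfLE (inf_le_left : (U j).1 ⊓ (U l).1 ⊓ (U m).1 ≤ (U j).1 ⊓ (U l).1)).op (h j l) -
          A.X.left.presheaf.map (homOfLE (le_inf (inf_le_left.trans inf_le_right) inf_le_right :
            (U j).1 ⊓ (U l).1 ⊓ (U m).1 ≤ (U l).1 ⊓ (U m).1)).op (h l m)) := by
  classical
  -- (1) `φ_L` injective ⇒ onto: every `cᵢ` is a contracted `dlog` of a GLOBAL vector field up to a coboundary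
  have key : ∀ i : σ, ∃ (D : (cotangentSheaf A.X).over ⊤ ⟶ (unitModule A.X.left).over ⊤)
      (e : (j : ι) → Γ(A.X.left, (U j).1)), ∀ j l : ι, c i j l =
        F.tfOn l j ((U j).1 ⊓ (U l).1) inf_le_right inf_le_left *
            (show Γ(A.X.left, (U j).1 ⊓ (U l).1) from
              appLE D (homOfLE le_top) (dSection A.X ((U j).1 ⊓ (U l).1) (F.tf j l))) +
          (A.X.left.presheaf.map (homOfLE (inf_le_right : (U j).1 ⊓ (U l).1 ≤ (U l).1)).op (e l) -
            A.X.left.presheaf.map (homOfLE (inf_le_left : (U j).1 ⊓ (U l).1 ≤ (U j).1)).op (e j)) :=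
    fun i => AbelianVariety.exists_vectorField_of_cechOneCocycle_of_injective A.toAffine.toAbelianVariety U hcov F
      (fun D e hD => A.vectorField_eq_zero_of_contracted_dlog_coboundary hL hε hΘ U hcov F D e hD) (c i) (hc i)
  choose D e hDe using key
  refine ⟨fun j l => ∑ i, a i j l • restrictHom (homOfLE (le_top : (U j).1 ⊓ (U l).1 ≤ ⊤)) (D i), ?_,
    fun j l => h' j l + ∑ i, a i j l *
      A.X.left.presheaf.map (homOfLE (inf_le_right : (U j).1 ⊓ (U l).1 ≤ (U l).1)).op (e i l), ?_⟩
  · -- (2) `θ_{jl} := ∑ᵢ aᵢ_{jl} • Dᵢ|` is a cocycle because the `aᵢ` are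
    intro j l m
    dsimp only
    rw [restrictHom_sum, restrictHom_sum, restrictHom_sum, ← Finset.sum_add_distrib]
    refine Finset.sum_congr rfl fun i _ => ?_
    rw [restrictHom_smul, restrictHom_smul, restrictHom_smul, restrictHom_restrictHom_top,
      restrictHom_restrictHom_top, restrictHom_restrictHom_top, ← add_smul, ha]
  · -- (3) the identity `s = g⁻¹ θ(dg) + δ⁻ h`
    intro j l m
    dsimp only
    have hl : (U j).1 ⊓ (U l).1 ⊓ (U m).1 ≤ (U l).1 := inf_le_left.trans inf_le_right
    have hm : (U j).1 ⊓ (U l).1 ⊓ (U m).1 ≤ (U m).1 := inf_le_right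
    have hjl : (U j).1 ⊓ (U l).1 ⊓ (U m).1 ≤ (U j).1 ⊓ (U l).1 := inf_le_left
    have hlm : (U j).1 ⊓ (U l).1 ⊓ (U m).1 ≤ (U l).1 ⊓ (U m).1 := le_inf hl hm
    have hjm : (U j).1 ⊓ (U l).1 ⊓ (U m).1 ≤ (U j).1 ⊓ (U m).1 :=
      le_inf (inf_le_left.trans inf_le_left) inf_le_right
    -- (a) the value of `θ_{jl}|` on `d(g_{lm}|)`
    have hθ : (show Γ(A.X.left, (U j).1 ⊓ (U l).1 ⊓ (U m).1) from
        appLE (restrictHom (homOfLE hjl) (∑ i, a i j l • restrictHom (homOfLE (le_top : (U j).1 ⊓ (U l).1 ≤ ⊤)) (D i)))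
          (𝟙 _) (dSection A.X _ (A.X.left.presheaf.map (homOfLE hlm).op (F.tf l m)))) =
        ∑ i, A.X.left.presheaf.map (homOfLE hjl).op (a i j l) *
          (show Γ(A.X.left, (U j).1 ⊓ (U l).1 ⊓ (U m).1) from
            appLE (D i) (homOfLE le_top) (dSection A.X _ (F.tfOn l m _ hl hm))) := by
      rw [F.map_tf, appLE_restrictHom, appLE_sum]
      change (∑ i, appLE (a i j l • restrictHom (homOfLE (le_top : (U j).1 ⊓ (U l).1 ≤ ⊤)) (D i))
        (𝟙 _ ≫ homOfLE hjl) (dSection A.X _ (F.tfOn l m _ (hlm.trans inf_le_left) (hlm.trans inf_le_right))) :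
          Γ(unitModule A.X.left, (U j).1 ⊓ (U l).1 ⊓ (U m).1)) = _
      refine Finset.sum_congr rfl fun i _ => ?_
      rw [appLE_smul, appLE_restrictHom]
      rfl
    -- (b) `cᵢ_{lm}|` on the triple overlap
    have hcV : ∀ i, A.X.left.presheaf.map (homOfLE hlm).op (c i l m) =
        F.tfOn m l _ hm hl *
            (show Γ(A.X.left, (U j).1 ⊓ (U l).1 ⊓ (U m).1) from
              appLE (D i) (homOfLE le_top) (dSection A.X _ (F.tfOn l m _ hl hm))) +
          (A.X.left.presheaf.map (homOfLE hm).op (e i m) - A.X.left.presheaf.map (homOfLE hl).op (e i l)) := by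
      intro i
      rw [hDe i l m, map_add, map_sub, Deformation.map_contractedDlog (fun j => (U j).1) F (D i) l m hlm,
        presheaf_map_map, presheaf_map_map]
    -- (c) the correcting cochain restricted to the triple overlap
    have hh : ∀ (p q : ι) (hpq : (U j).1 ⊓ (U l).1 ⊓ (U m).1 ≤ (U p).1 ⊓ (U q).1)
        (hq : (U j).1 ⊓ (U l).1 ⊓ (U m).1 ≤ (U q).1),
        A.X.left.presheaf.map (homOfLE hpq).op
            (h' p q + ∑ i, a i p q *
              A.X.left.presheaf.map (homOfLE (inf_le_right : (U p).1 ⊓ (U q).1 ≤ (U q).1)).op (e i q)) =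
          A.X.left.presheaf.map (homOfLE hpq).op (h' p q) +
            ∑ i, A.X.left.presheaf.map (homOfLE hpq).op (a i p q) *
              A.X.left.presheaf.map (homOfLE hq).op (e i q) := by
      intro p q hpq hq
      rw [map_add, map_sum]
      refine congrArg _ (Finset.sum_congr rfl fun i _ => ?_)
      rw [map_mul, presheaf_map_map]
    -- (d) assemble
    dsimp only at hθ hcV
    rw [hθ, hJ3, hh j m hjm hm, hh j l hjl hl, hh l m hlm hm, F.map_tfOn]
    simp only [hcV]
    exact sum_bookkeeping _ _ _ _ _ _ _ _ _ _ fun i => ha i j l m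

end Literature.AlgebraicGeometry.AbelianSchemes

end
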